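import Literature.NumberTheory.Transcendental.ManyCurveSiegelG
import Literature.NumberTheory.Transcendental.ManyCurveEngine
import Literature.NumberTheory.Transcendental.BakerNewPointsG
import HarnessLib

/-!
# Baker's method on the `k`-lattice standard models at a general algebraic point: theta lower bound, extrapolation, new points, envelopes

Topic `Literature/NumberTheory/Transcendental`; a proofs-and-definitions file (no named facts) towards the
Semistability Theorem (Baker–Wüstholz 2007, Thm. 6.15) for the FAMILY standard models `M = 𝔾ₘ^β × P` at ALL
algebraic points, after `ManyCurveBakerG.lean` (data, field, heights) and `ManyCurveSiegelG.lean` (Siegel step,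
line values, Liouville).  It is the family twin of the `BakerDataG` part of `ThetaBaseLowerBoundG.lean` and of
`BakerNewPointsG.lean` (one lattice, all algebraic points) — their text VERBATIM on the family theta model of
`ManyCurveTheta.lean` (each block `b` with its own lattice `Λ_{cls b}`; `theta/thetaEval/extrapFun L cls κM`):

* the lower bound `c·e^{−C(s+1)³} ≤ |Θ_{J₀(c_s)}(s·v)|` for the base theta function at the multiples of a
  reduced algebraic point (`exists_theta_baseIdx_ge`: for a non-torsion block `℘_{cls b}` is large near the
  lattice while `‖℘(s z_b)‖ ≤ gBound s`, and `σ` is bounded below away from the lattice,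
  `PeriodPair.exists_norm_weierstrassSigma_ge`);
* the point step (`vanishesAlong_of_levels`, `vanishesAlong_of_small`), the extrapolation estimate with scaled
  radius (`norm_extrapFun_grid_le₂`), the numerical condition `NumCond₂`, the vanishing at the new points and
  **the scaled engine `engine₂`**;
* the envelopes of the closing numerics (`bigConst`, `houseBound_le`, `siegelHouseBound_le`, `houseXi_le`,
  `dAt_pow_le`, `orderLoss_le`, `growth_le`, `rhs_ge`, `lineValBound_le`).

Everything is proved; no named facts.

## References

* A. Baker, G. Wüstholz, *Logarithmic Forms and Diophantine Geometry*, CUP 2007, §6.8 (pp. 117–119).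
  [BakerWustholz2007]
* A. Baker, *Transcendental Number Theory*, CUP 1975, Ch. 2, Lemmas 4–5. [BakerTNT1975]
-/

noncomputable section

open Complex Filter Metric Set
open scoped PeriodPair Topology

namespace Literature.NumberTheory.Transcendental

namespace GaGmEFam

namespace Std

open GaGmE (Kbar)
open GaGmE.Std (iy iz is coords coords_iy coords_iz coords_is sum_blocks ThetaIdx thetaT thetaT_none
  thetaT_some differentiable_thetaT VanishesAlong isAlgebraic_coe_Kbar
  Gen factorGen zetaHat zetaHatDer factorODE zetaHatODE FactorChartValid isOpen_factorChartValid
  factorGen_false factorGen_true zetaHat_false zetaHat_true hasDerivAt_zetaHat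
  baseFin baseIdx rPoly corrPoly TPoly rVal corrVal factor_blocks line_apply genFin genIdx
  rVal_baseFin corrVal_baseFin rVal_genFin genericChart affGen affIdx homog isHomogeneous_homog
  eval_homog_of_base_eq_one factorODEᵣ zetaHatODEᵣ rPolyᵣ corrPolyᵣ TPolyᵣ homogMonomialᵣ
  map_homogMonomialᵣ homog_monomial homog_add homog_zero homog_sum homog_eq_sum)

namespace BakerDataG

variable {𝓙 : Type} [Fintype 𝓙] [DecidableEq 𝓙] {β γ δ : Type} [Fintype β] [Fintype γ] [Fintype δ] [DecidableEq γ]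
variable (B : BakerDataG 𝓙 β γ δ)

/-! ### The base theta function at the points `s·v` of a general algebraic point -/

/-- **`℘(s z_b)` is bounded by the height**: `‖℘(s z_b)‖ ≤ gBound s` for a non-torsion coordinate
and `s ≥ 1` (it is a conjugate of the generator value `x(sP_b) ∈ K`). [folklore] -/
theorem norm_weierstrassP_smul_le (B : BakerDataG 𝓙 β γ δ) {b : γ} (hb : B.latCo b = none) {s : ℕ} (hs : s ≠ 0) :
    ‖℘[B.L (B.cls b)] ((s : ℂ) * B.z b)‖ ≤ B.gBound s := by
  have h := B.norm_embedding_gK_le B.emb s (Sum.inr (Sum.inl (b, 0)))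
  have e : B.gK s (Sum.inr (Sum.inl (b, 0))) = B.xsK s b := by
    simp [gK, facK, hb, hs]
  rw [e, (B.emb_xsK_ysK hb hs).1] at h
  exact h

/-- **Per-factor lower bound.** For each `E`-coordinate `b` there are `c > 0`, `C ≥ 0` with
`c·e^{−C(s+1)³} ≤ |P_{i_b(s)}(s·z_b)|` for all `s ∈ ℕ`, `i_b(s) = 2` in the origin chart (lattice
coordinate, or `s = 0`) and `0` otherwise. For a non-torsion coordinate: `℘` is large near the
lattice while `‖℘(s z_b)‖ ≤ gBound s`, so `s z_b` keeps a distance `≫ gBound(s)⁻¹` from `Λ`, and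
`σ` is bounded below away from `Λ` (`PeriodPair.exists_norm_weierstrassSigma_ge`).
[cite: BakerWustholz2007, §6.8 (p. 119: log max |f_i(sv)| ≫ −(s²+1)‖v‖²)] -/
theorem exists_univExtP_base_ge (B : BakerDataG 𝓙 β γ δ) (b : γ) : ∃ c : ℝ, 0 < c ∧ ∃ C : ℝ, 0 ≤ C ∧ ∀ s : ℕ,
    c * Real.exp (-(C * ((s : ℝ) + 1) ^ 3)) ≤
      ‖(B.L (B.cls b)).univExtP (baseFin (chartChoiceAt B.L B.cls (β := β) (δ := δ) ((s : ℂ) • B.v) b)) ((s : ℂ) * B.v (iz b))‖ := by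
  have hchart : ∀ s : ℕ, chartChoiceAt B.L B.cls (β := β) (δ := δ) ((s : ℂ) • B.v) b = decide (B.latCo b ≠ none ∨ s = 0) :=
    fun s => B.chartChoiceAt_smul s b
  have cube1 : ∀ s : ℕ, (1 : ℝ) ≤ ((s : ℝ) + 1) ^ 3 := fun s => (GaGmE.Std.BakerDataG.cube_facts s).1
  rcases hb : B.latCo b with _ | mn
  · -- non-torsion coordinate
    set z : ℂ := B.z b with hz
    obtain ⟨r₀, hr₀, C₀, hC₀0, h℘⟩ := (B.L (B.cls b)).exists_weierstrassP_norm_ge_near_lattice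
    obtain ⟨cσ, hcσ, Cσ, hCσ0, r₁, hr₁, hσ⟩ := (B.L (B.cls b)).exists_norm_weierstrassSigma_ge
    set a : ℝ := min r₀ r₁ with ha
    have ha0 : 0 < a := lt_min hr₀ hr₁
    have hm0 : 0 < min a 1 := lt_min ha0 one_pos
    set c' : ℝ := cσ * (min a 1 / (1 + C₀)) with hc'
    have hc'0 : 0 < c' := by positivity
    set C' : ℝ := B.Cg + Cσ * (1 + ‖z‖ ^ 2) with hC'
    have hCg := B.Cg_nonneg
    have hC'0 : 0 ≤ C' := by positivity
    refine ⟨min 2 (c' ^ 3), lt_min two_pos (pow_pos hc'0 3), 3 * C', by positivity, fun s => ?_⟩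
    have hexp1 : Real.exp (-(3 * C' * ((s : ℝ) + 1) ^ 3)) ≤ 1 := by
      have : 0 ≤ 3 * C' * ((s : ℝ) + 1) ^ 3 := by positivity
      exact Real.exp_le_one_iff.mpr (by linarith)
    by_cases hs : s = 0
    · -- `s = 0`: origin chart, `‖P₂(0)‖ = 2`
      subst hs
      have hc : chartChoiceAt B.L B.cls (β := β) (δ := δ) (((0 : ℕ) : ℂ) • B.v) b = true := by rw [hchart]; simp
      rw [hc]
      simp only [baseFin, if_true, Nat.cast_zero, zero_mul]
      have hP20 : ‖(B.L (B.cls b)).univExtP 2 0‖ = 2 := by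
        have := (B.L (B.cls b)).norm_univExtP_two_lattice 0 0
        simpa using this
      rw [hP20]
      have : min 2 (c' ^ 3) * Real.exp (-(3 * C' * (((0 : ℕ) : ℝ) + 1) ^ 3)) ≤ 2 * 1 :=
        mul_le_mul (min_le_left _ _) hexp1 (Real.exp_nonneg _) zero_le_two
      simpa using this
    · -- `s ≥ 1`: generic chart, `P₀(sz) = σ(sz)³`
      have hc : chartChoiceAt B.L B.cls (β := β) (δ := δ) ((s : ℂ) • B.v) b = false := by rw [hchart]; simp [hb, hs]
      rw [hc]
      simp only [baseFin, Bool.false_eq_true, if_false]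
      have hsz : (s : ℂ) * z ∉ (B.L (B.cls b)).lattice := B.nat_mul_z_notMem hb hs
      rw [show B.v (iz b) = z from rfl, (PeriodPair.univExtP_eq hsz).1, norm_pow]
      -- the distance of `sz` to the lattice
      set G : ℝ := B.gBound s with hG
      have hG1 : 1 ≤ G := B.one_le_gBound s
      set A : ℝ := G + C₀ with hA
      have hA1 : 1 ≤ A := by linarith
      have hA0 : 0 < A := by linarith
      set ε : ℝ := min a A⁻¹ with hε
      have hε0 : 0 < ε := lt_min ha0 (inv_pos.mpr hA0)
      have hεr₁ : ε ≤ r₁ := (min_le_left _ _).trans (min_le_right _ _)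
      have hεr₀ : ε ≤ r₀ := (min_le_left _ _).trans (min_le_left _ _)
      have hε1 : ε ≤ 1 := (min_le_right _ _).trans (inv_le_one_of_one_le₀ hA1)
      have h℘s : ‖℘[B.L (B.cls b)] ((s : ℂ) * z)‖ ≤ G := B.norm_weierstrassP_smul_le hb hs
      have hdist : ∀ lam ∈ (B.L (B.cls b)).lattice, ε ≤ ‖(s : ℂ) * z - lam‖ := by
        intro lam hlam
        by_contra hlt
        push Not at hlt
        set d : ℝ := ‖(s : ℂ) * z - lam‖ with hd
        have hdpos : 0 < d := by
          rw [hd, norm_pos_iff, sub_ne_zero]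
          rintro rfl; exact hsz hlam
        have h1 := h℘ lam hlam ((s : ℂ) * z) hdpos (hlt.le.trans hεr₀)
        have h2 : (d ^ 2)⁻¹ ≤ A := by rw [hA]; linarith
        have h3 : A⁻¹ ≤ d ^ 2 := by rw [inv_le_comm₀ hA0 (by positivity)]; exact h2
        have h4 : d ^ 2 ≤ d := by
          have : d ≤ 1 := hlt.le.trans hε1
          nlinarith
        have : A⁻¹ ≤ d := h3.trans h4
        have : ε ≤ d := (min_le_right _ _).trans this
        linarith
      have hσs := hσ ((s : ℂ) * z) ε hε0 hεr₁ hdist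
      -- lower bounds for the factors
      have hεge : (min a 1 / (1 + C₀)) * Real.exp (-(B.Cg * ((s : ℝ) + 1) ^ 3)) ≤ ε := by
        have h1 : min a 1 / A ≤ ε := GaGmE.Std.BakerDataG.min_inv_ge ha0.le hA1
        refine le_trans ?_ h1
        have hGe : G = Real.exp (B.Cg * ((s : ℝ) + 1) ^ 3) := (B.exp_Cg_mul_eq s).symm
        have hAle : A ≤ G * (1 + C₀) := by rw [hA]; nlinarith
        calc min a 1 / (1 + C₀) * Real.exp (-(B.Cg * ((s : ℝ) + 1) ^ 3))
            = min a 1 / (G * (1 + C₀)) := by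
              rw [Real.exp_neg, ← hGe]; field_simp
          _ ≤ min a 1 / A := div_le_div_of_nonneg_left hm0.le hA0 hAle
      have hexpge : Real.exp (-(Cσ * (1 + ‖z‖ ^ 2) * ((s : ℝ) + 1) ^ 3)) ≤
          Real.exp (-(Cσ * (1 + ‖(s : ℂ) * z‖ ^ 2))) := by
        refine Real.exp_le_exp.mpr (neg_le_neg ?_)
        rw [norm_mul, Complex.norm_natCast, mul_assoc]
        refine mul_le_mul_of_nonneg_left ?_ hCσ0
        have hs0 : (0 : ℝ) ≤ s := Nat.cast_nonneg s
        have c3 := (GaGmE.Std.BakerDataG.cube_facts s).2.2.1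
        nlinarith [sq_nonneg ((s : ℝ) * ‖z‖), sq_nonneg ‖z‖, norm_nonneg z, cube1 s,
          mul_nonneg (sq_nonneg ‖z‖) (sub_nonneg.mpr c3)]
      have hσge : c' * Real.exp (-(C' * ((s : ℝ) + 1) ^ 3)) ≤ ‖(B.L (B.cls b)).weierstrassSigma ((s : ℂ) * z)‖ := by
        refine le_trans ?_ hσs
        have e : c' * Real.exp (-(C' * ((s : ℝ) + 1) ^ 3)) =
            cσ * ((min a 1 / (1 + C₀)) * Real.exp (-(B.Cg * ((s : ℝ) + 1) ^ 3))) *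
              Real.exp (-(Cσ * (1 + ‖z‖ ^ 2) * ((s : ℝ) + 1) ^ 3)) := by
          rw [hc', hC', show -((B.Cg + Cσ * (1 + ‖z‖ ^ 2)) * ((s : ℝ) + 1) ^ 3) =
            -(B.Cg * ((s : ℝ) + 1) ^ 3) + -(Cσ * (1 + ‖z‖ ^ 2) * ((s : ℝ) + 1) ^ 3) by ring, Real.exp_add]
          ring
        rw [e]
        exact mul_le_mul (mul_le_mul_of_nonneg_left hεge hcσ.le) hexpge (Real.exp_nonneg _) (by positivity)
      -- cube
      have hbase0 : 0 ≤ c' * Real.exp (-(C' * ((s : ℝ) + 1) ^ 3)) := by positivity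
      calc min 2 (c' ^ 3) * Real.exp (-(3 * C' * ((s : ℝ) + 1) ^ 3))
          ≤ c' ^ 3 * Real.exp (-(3 * C' * ((s : ℝ) + 1) ^ 3)) :=
            mul_le_mul_of_nonneg_right (min_le_right _ _) (Real.exp_nonneg _)
        _ = (c' * Real.exp (-(C' * ((s : ℝ) + 1) ^ 3))) ^ 3 := by
            have e3 : Real.exp (-(3 * C' * ((s : ℝ) + 1) ^ 3)) = Real.exp (-(C' * ((s : ℝ) + 1) ^ 3)) ^ 3 := by
              rw [← Real.exp_nat_mul]; congr 1; push_cast; ring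
            rw [e3]; ring
        _ ≤ ‖(B.L (B.cls b)).weierstrassSigma ((s : ℂ) * z)‖ ^ 3 := pow_le_pow_left₀ hbase0 hσge 3
  · -- lattice coordinate: `‖P₂(sλ)‖ = 2 e^{3 s² Re(η(λ)λ/2)}`
    set X₀ : ℂ := ((mn.1 : ℂ) * (B.L (B.cls b)).η₁ + (mn.2 : ℂ) * (B.L (B.cls b)).η₂) * (((mn.1 : ℂ) * (B.L (B.cls b)).ω₁ + (mn.2 : ℂ) * (B.L (B.cls b)).ω₂) / 2)
      with hX₀
    refine ⟨2, two_pos, 3 * ‖X₀‖, by positivity, fun s => ?_⟩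
    have hc : chartChoiceAt B.L B.cls (β := β) (δ := δ) ((s : ℂ) • B.v) b = true := by rw [hchart]; simp [hb]
    rw [hc]
    simp only [baseFin, if_true]
    rw [show B.v (iz b) = B.z b from rfl, B.z_eq_of_some hb,
      show (s : ℂ) * ((mn.1 : ℂ) * (B.L (B.cls b)).ω₁ + (mn.2 : ℂ) * (B.L (B.cls b)).ω₂) =
        ((s * mn.1 : ℤ) : ℂ) * (B.L (B.cls b)).ω₁ + ((s * mn.2 : ℤ) : ℂ) * (B.L (B.cls b)).ω₂ by push_cast; ring,
      (B.L (B.cls b)).norm_univExtP_two_lattice]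
    have hx : (((s * mn.1 : ℤ) : ℂ) * (B.L (B.cls b)).η₁ + ((s * mn.2 : ℤ) : ℂ) * (B.L (B.cls b)).η₂) *
        ((((s * mn.1 : ℤ) : ℂ) * (B.L (B.cls b)).ω₁ + ((s * mn.2 : ℤ) : ℂ) * (B.L (B.cls b)).ω₂) / 2) = ((s : ℂ) ^ 2) * X₀ := by
      rw [hX₀]; push_cast; ring
    rw [hx, ← Real.exp_nat_mul]
    refine mul_le_mul_of_nonneg_left (Real.exp_le_exp.mpr ?_) zero_le_two
    have hre : -‖((s : ℂ) ^ 2) * X₀‖ ≤ (((s : ℂ) ^ 2) * X₀).re := by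
      have := Complex.abs_re_le_norm (((s : ℂ) ^ 2) * X₀)
      have := neg_abs_le (((s : ℂ) ^ 2) * X₀).re
      linarith
    have hn : ‖((s : ℂ) ^ 2) * X₀‖ = (s : ℝ) ^ 2 * ‖X₀‖ := by
      rw [norm_mul, norm_pow, Complex.norm_natCast]
    have c3 := (GaGmE.Std.BakerDataG.cube_facts s).2.2.1
    have hs0 : (0 : ℝ) ≤ s := Nat.cast_nonneg s
    have hsq : (s : ℝ) ^ 2 ≤ ((s : ℝ) + 1) ^ 3 := by nlinarith
    push_cast
    nlinarith [norm_nonneg X₀, mul_le_mul_of_nonneg_right hsq (norm_nonneg X₀)]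

/-- **Lower bound for the base theta function at the points `s·v`.** There are `c > 0` and
`C ≥ 0`, depending only on the data, with `c·e^{−C(s+1)³} ≤ |Θ_{J₀(c_s)}(s·v)|` for all `s ∈ ℕ`.
[cite: BakerWustholz2007, §6.8 (p. 119)] -/
theorem exists_theta_baseIdx_ge (B : BakerDataG 𝓙 β γ δ) : ∃ c : ℝ, 0 < c ∧ ∃ C : ℝ, 0 ≤ C ∧ ∀ s : ℕ,
    c * Real.exp (-(C * ((s : ℝ) + 1) ^ 3)) ≤ ‖theta B.L B.cls B.κM (baseIdx (chartChoiceAt B.L B.cls ((s : ℂ) • B.v))) ((s : ℂ) • B.v)‖ := by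
  choose c hc C hC h using fun b => B.exists_univExtP_base_ge b
  refine ⟨∏ b, c b, Finset.prod_pos fun b _ => hc b, ∑ b, C b, Finset.sum_nonneg fun b _ => hC b, fun s => ?_⟩
  rw [theta_baseIdx, norm_prod]
  have e : (∏ b, c b) * Real.exp (-((∑ b, C b) * ((s : ℝ) + 1) ^ 3)) =
      ∏ b, c b * Real.exp (-(C b * ((s : ℝ) + 1) ^ 3)) := by
    rw [Finset.prod_mul_distrib, ← Real.exp_sum]
    congr 1
    rw [Finset.sum_mul, ← Finset.sum_neg_distrib]
  rw [e]
  refine Finset.prod_le_prod (fun b _ => by have := hc b; positivity) fun b _ => ?_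
  simpa [Pi.smul_apply, smul_eq_mul] using h b s

end BakerDataG

end Std

end GaGmEFam

end Literature.NumberTheory.Transcendental

end

noncomputable section

open Complex Metric Set MvPolynomial Finset NumberField
open scoped PeriodPair

namespace Literature.NumberTheory.Transcendental

namespace GaGmEFam

namespace Std

open GaGmE (Kbar)
open GaGmE.Std (iy iz is coords coords_iy coords_iz coords_is sum_blocks ThetaIdx thetaT thetaT_none
  thetaT_some differentiable_thetaT VanishesAlong isAlgebraic_coe_Kbar
  Gen factorGen zetaHat zetaHatDer factorODE zetaHatODE FactorChartValid isOpen_factorChartValid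
  factorGen_false factorGen_true zetaHat_false zetaHat_true hasDerivAt_zetaHat
  baseFin baseIdx rPoly corrPoly TPoly rVal corrVal factor_blocks line_apply genFin genIdx
  rVal_baseFin corrVal_baseFin rVal_genFin genericChart affGen affIdx homog isHomogeneous_homog
  eval_homog_of_base_eq_one factorODEᵣ zetaHatODEᵣ rPolyᵣ corrPolyᵣ TPolyᵣ homogMonomialᵣ
  map_homogMonomialᵣ homog_monomial homog_add homog_zero homog_sum homog_eq_sum)

namespace BakerDataG

open GaGmE.Std.BakerData (UIdx νOf νOf_apply νOf_injective degree_νOf_le card_UIdx lin_quad_le)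

variable {𝓙 : Type} [Fintype 𝓙] [DecidableEq 𝓙] {β γ δ : Type} [Fintype β] [Fintype γ] [Fintype δ] [DecidableEq γ]
variable [DecidableEq β] [DecidableEq δ] (B : BakerDataG 𝓙 β γ δ)

/-- The analytic subgroup direction space `𝔟 = ⟨x_1, …, x_dd⟩`. [folklore] -/
abbrev bSpan : Submodule ℂ (β ⊕ (γ ⊕ δ) → ℂ) := Submodule.span ℂ (Set.range B.xs)

/-- The grid directions `x_c = ∑ c_m x_m`. [folklore] -/
def gridDir (cg : Fin B.dd → ℕ) : β ⊕ (γ ⊕ δ) → ℂ := ∑ m, (cg m : ℂ) • B.xs m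

omit [DecidableEq β] [DecidableEq δ] in
/-- Grid directions lie in `𝔟`. [folklore] -/
theorem gridDir_mem (B : BakerDataG 𝓙 β γ δ) (cg : Fin B.dd → ℕ) : B.gridDir cg ∈ B.bSpan :=
  Submodule.sum_mem _ fun m _ => Submodule.smul_mem _ _ (Submodule.subset_span ⟨m, rfl⟩)

/-- The auxiliary form attached to `ξ`: `P = homog (nD') (QOf ξ)`. [folklore] -/
abbrev auxForm {D' : ℕ} (ξ : UIdx β γ δ D' → 𝓞 B.K) : MvPolynomial (Option β × ThetaIdx γ δ) ℂ :=
  homog (Fintype.card (β ⊕ (γ ⊕ δ)) * D') (B.QOf ξ)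

/-- **Lower levels give vanishing along `𝔟`.** If `p_{s,k'} = 0` for all `k' < k` then `F_P`
vanishes to order `≥ k` along `𝔟` at `s·v`. [folklore] -/
theorem vanishesAlong_of_levels (B : BakerDataG 𝓙 β γ δ) {D' : ℕ} (ξ : UIdx β γ δ D' → 𝓞 B.K) (s : ℕ) {k : ℕ}
    (h : ∀ k' < k, B.lineValPoly ξ s k' = 0) :
    VanishesAlong B.bSpan (thetaEval B.L B.cls B.κM (B.auxForm ξ)) ((s : ℂ) • B.v) k := by
  refine vanishesAlong_span_of_wordForms B.L B.cls B.κM (isHomogeneous_homog _ _) (B.cAt s)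
    (fun x => zero_mem_chartDomain_chartChoiceAt B.L B.cls _ x) B.xs k fun k' hk' α => ?_
  have e := B.emb_coeff_lineValPoly ξ s k' (fun m => (α m : ℕ))
  rw [h k' hk', coeff_zero, map_zero] at e
  exact e.symm

/-- **The inductive step at a new point.** Let `s ∈ ℕ`, `T'`, and suppose that for every
`k < T'` and every grid direction `x_c` (`c_m ≤ k`) the extrapolation function satisfies
`|φ_{x_c,k}(s)| · |d_s|^{E} · (|d_s|^{E}·lineValBound)^{h-1} < |Θ_{J₀(c_s)}(s·v)|^D`. Then `F_P`
vanishes to order `≥ T'` along `𝔟` at `s·v`. [cite: BakerWustholz2007, §6.8 (p. 119)] -/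
theorem vanishesAlong_of_small (B : BakerDataG 𝓙 β γ δ) {D' : ℕ} (ξ : UIdx β γ δ D' → 𝓞 B.K) (s T' : ℕ)
    (hφ : ∀ k < T', ∀ cg : Fin B.dd → ℕ, (∀ m, cg m ≤ k) →
      ‖extrapFun B.L B.cls B.κM (B.auxForm ξ) B.v (B.gridDir cg) k s‖ *
        (|(B.dAt s : ℝ)| ^ B.expE (Fintype.card (β ⊕ (γ ⊕ δ)) * D') k *
          (|(B.dAt s : ℝ)| ^ B.expE (Fintype.card (β ⊕ (γ ⊕ δ)) * D') k * B.lineValBound ξ s k) ^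
            (B.gens.h - 1)) <
        ‖theta B.L B.cls B.κM (baseIdx (B.cAt s)) ((s : ℂ) • B.v)‖ ^ (Fintype.card (β ⊕ (γ ⊕ δ)) * D')) :
    VanishesAlong B.bSpan (thetaEval B.L B.cls B.κM (B.auxForm ξ)) ((s : ℂ) • B.v) T' := by
  set D := Fintype.card (β ⊕ (γ ⊕ δ)) * D' with hD
  -- all levels below `T'` vanish, by strong induction
  have hlev : ∀ k < T', B.lineValPoly ξ s k = 0 := by
    intro k
    induction k using Nat.strong_induction_on with
    | _ k ih =>
      intro hk
      have hvan : VanishesAlong B.bSpan (thetaEval B.L B.cls B.κM (B.auxForm ξ)) ((s : ℂ) • B.v) k :=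
        B.vanishesAlong_of_levels ξ s fun k' hk' => ih k' hk' (hk'.trans hk)
      -- every grid value vanishes
      have hgrid : ∀ cg : Fin B.dd → ℕ, (∀ m, cg m ≤ k) →
          MvPolynomial.eval (fun m => (cg m : B.K)) (B.lineValPoly ξ s k) = 0 := by
        intro cg hcg
        have hlow : ∀ i < k, iteratedDeriv i (fun t : ℂ => thetaEval B.L B.cls B.κM (B.auxForm ξ)
            ((s : ℂ) • B.v + t • ∑ m, (cg m : ℂ) • B.xs m)) 0 = 0 :=
          fun i hi => hvan _ (B.gridDir_mem cg) i hi
        have hval := B.iteratedDeriv_grid_eq ξ s k cg hlow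
        have hsmall := hφ k hk cg hcg
        -- `φ = Θ₀^D · emb p`
        have hφeq : extrapFun B.L B.cls B.κM (B.auxForm ξ) B.v (B.gridDir cg) k s =
            theta B.L B.cls B.κM (baseIdx (B.cAt s)) ((s : ℂ) • B.v) ^ D *
              B.emb (MvPolynomial.eval (fun m => (cg m : B.K)) (B.lineValPoly ξ s k)) := hval
        rw [hφeq, norm_mul, norm_pow, mul_assoc] at hsmall
        have hΘ : 0 < ‖theta B.L B.cls B.κM (baseIdx (B.cAt s)) ((s : ℂ) • B.v)‖ ^ D := by
          obtain ⟨c, hc, C, -, hge⟩ := B.exists_theta_baseIdx_ge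
          exact pow_pos (lt_of_lt_of_le (by have := hge s; positivity) (hge s)) D
        refine B.lineVal_eq_zero_of_norm_lt ξ s k hcg ?_
        have := (mul_lt_iff_lt_one_right hΘ).mp hsmall
        rw [← hD, mul_assoc]
        exact this
      -- the grid lemma
      refine MvPolynomial.eq_zero_of_eval_zero_at_prod_finset _
        (fun _ => (Finset.range (k + 1)).image (fun j : ℕ => (j : B.K))) (fun m => ?_) (fun x hx => ?_)
      · rw [Finset.card_image_of_injective _ Nat.cast_injective, Finset.card_range]
        exact Nat.lt_succ_of_le (B.degreeOf_lineValPoly_le ξ s k m)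
      · have hx' : ∀ m, ∃ j : ℕ, j ≤ k ∧ (j : B.K) = x m := fun m => by
          obtain ⟨j, hj, hjx⟩ := Finset.mem_image.mp (hx m)
          exact ⟨j, Nat.lt_succ_iff.mp (Finset.mem_range.mp hj), hjx⟩
        choose cg hcg hcgx using hx'
        have hxe : x = fun m => (cg m : B.K) := funext fun m => (hcgx m).symm
        rw [hxe]
        exact hgrid cg hcg
  exact B.vanishesAlong_of_levels ξ s hlev


end BakerDataG

end Std

end GaGmEFam

end Literature.NumberTheory.Transcendental

end

/-!
# Baker's method on `M_κ` at a general algebraic point: the extrapolation estimate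

Topic: `Literature/NumberTheory/Transcendental`. Unit
`provefact-Literature.NumberTheory.Transcendental.s-efcbe22610` (fact `semistabilityTheorem_std`).
Verbatim port to the general-point data `BakerDataG` (`BakerFieldG.lean` and sequels) of the
corresponding `BakerData` file(s) of the torsion-point chain (see the module docstring below the
imports of those files for the mathematics); the only changes are the shapes of the arithmetic of
the point (`gBound s`, `d_s = d₁·pden s`) and of the lower bound for the base theta function
(`c·e^{−C(s+1)³}`). Everything is proved; no named facts.

## References

* A. Baker, G. Wüstholz, *Logarithmic Forms and Diophantine Geometry*, CUP 2007, §6.8 (pp. 118–119).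
* A. Baker, *Transcendental Number Theory*, CUP 1975, Ch. 2, Lemmas 4–5.
-/

noncomputable section

open Complex Metric Set MvPolynomial Finset NumberField
open scoped PeriodPair

namespace Literature.NumberTheory.Transcendental

namespace GaGmEFam

namespace Std

open GaGmE (Kbar)
open GaGmE.Std (iy iz is coords coords_iy coords_iz coords_is sum_blocks ThetaIdx thetaT thetaT_none
  thetaT_some differentiable_thetaT VanishesAlong isAlgebraic_coe_Kbar
  Gen factorGen zetaHat zetaHatDer factorODE zetaHatODE FactorChartValid isOpen_factorChartValid
  factorGen_false factorGen_true zetaHat_false zetaHat_true hasDerivAt_zetaHat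
  baseFin baseIdx rPoly corrPoly TPoly rVal corrVal factor_blocks line_apply genFin genIdx
  rVal_baseFin corrVal_baseFin rVal_genFin genericChart affGen affIdx homog isHomogeneous_homog
  eval_homog_of_base_eq_one factorODEᵣ zetaHatODEᵣ rPolyᵣ corrPolyᵣ TPolyᵣ homogMonomialᵣ
  map_homogMonomialᵣ homog_monomial homog_add homog_zero homog_sum homog_eq_sum)

namespace BakerDataG

open GaGmE.Std.BakerData (UIdx νOf νOf_apply νOf_injective degree_νOf_le card_UIdx lin_quad_le)

variable {𝓙 : Type} [Fintype 𝓙] [DecidableEq 𝓙] {β γ δ : Type} [Fintype β] [Fintype γ] [Fintype δ] [DecidableEq γ]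
variable [DecidableEq β] [DecidableEq δ] (B : BakerDataG 𝓙 β γ δ)

/-! ### Sizes of the auxiliary form and of the grid directions -/

/-- `‖homog D (QOf ξ)‖₁ ≤ ∑_u |ξ_u|`. [folklore] -/
theorem l1Norm_homog_QOf_le (B : BakerDataG 𝓙 β γ δ) {D' : ℕ} (ξ : UIdx β γ δ D' → 𝓞 B.K) :
    Nesterenko.l1Norm (B.auxForm ξ) ≤ ∑ u, ‖B.emb ((ξ u : 𝓞 B.K) : B.K)‖ := by
  unfold Nesterenko.l1Norm auxForm
  rw [homog_QOf]
  -- `coeff_J (∑_u C a_u * m_u) = ∑_u a_u * coeff_J m_u` and `∑_J |coeff_J m_u| = 1`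
  set D := Fintype.card (β ⊕ (γ ⊕ δ)) * D' with hD
  have hmon : ∀ u : UIdx β γ δ D', ∃ J : (Option β × ThetaIdx γ δ) →₀ ℕ,
      (homogMonomialᵣ D (νOf u) : MvPolynomial (Option β × ThetaIdx γ δ) ℂ) = monomial J 1 := by
    intro u
    refine ⟨Finsupp.single (baseIdx (genericChart (γ := γ))) (D - (νOf u).degree) + (νOf u).mapDomain affIdx, ?_⟩
    rw [homogMonomialᵣ, X_pow_eq_monomial, monomial_mul, one_mul]
  choose J hJ using hmon
  have hsum : (∑ u, C (B.emb ((ξ u : 𝓞 B.K) : B.K)) * homogMonomialᵣ D (νOf u) :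
      MvPolynomial (Option β × ThetaIdx γ δ) ℂ) = ∑ u, monomial (J u) (B.emb ((ξ u : 𝓞 B.K) : B.K)) := by
    refine Finset.sum_congr rfl fun u _ => ?_
    rw [hJ u, C_mul_monomial, mul_one]
  rw [hsum]
  -- bound the ℓ¹ norm of a sum of monomials
  calc ∑ I ∈ (∑ u, monomial (J u) (B.emb ((ξ u : 𝓞 B.K) : B.K))).support,
        ‖coeff I (∑ u, monomial (J u) (B.emb ((ξ u : 𝓞 B.K) : B.K)))‖
      ≤ ∑ I ∈ (∑ u, monomial (J u) (B.emb ((ξ u : 𝓞 B.K) : B.K))).support,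
          ∑ u, ‖coeff I (monomial (J u) (B.emb ((ξ u : 𝓞 B.K) : B.K)))‖ := by
        refine Finset.sum_le_sum fun I _ => ?_
        rw [coeff_sum]
        exact norm_sum_le _ _
    _ = ∑ u, ∑ I ∈ (∑ u, monomial (J u) (B.emb ((ξ u : 𝓞 B.K) : B.K))).support,
          ‖coeff I (monomial (J u) (B.emb ((ξ u : 𝓞 B.K) : B.K)))‖ := Finset.sum_comm
    _ ≤ ∑ u, ‖B.emb ((ξ u : 𝓞 B.K) : B.K)‖ := by
        refine Finset.sum_le_sum fun u _ => ?_
        by_cases hmem : J u ∈ (∑ u, monomial (J u) (B.emb ((ξ u : 𝓞 B.K) : B.K))).support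
        · rw [← Finset.add_sum_erase _ _ hmem, coeff_monomial, if_pos rfl]
          have : ∑ I ∈ ((∑ u, monomial (J u) (B.emb ((ξ u : 𝓞 B.K) : B.K))).support).erase (J u),
              ‖coeff I (monomial (J u) (B.emb ((ξ u : 𝓞 B.K) : B.K)))‖ = 0 := by
            refine Finset.sum_eq_zero fun I hI => ?_
            rw [coeff_monomial, if_neg (Finset.ne_of_mem_erase hI).symm, norm_zero]
          rw [this, add_zero]
        · have h0 : ∑ I ∈ (∑ u, monomial (J u) (B.emb ((ξ u : 𝓞 B.K) : B.K))).support,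
              ‖coeff I (monomial (J u) (B.emb ((ξ u : 𝓞 B.K) : B.K)))‖ = 0 :=
            Finset.sum_eq_zero fun I hI => by
              rw [coeff_monomial, if_neg (fun h => hmem (by rw [h]; exact hI)), norm_zero]
          rw [h0]; exact norm_nonneg _

/-- `∑_u |ξ_u| ≤ #U · H_ξ`. [folklore] -/
theorem sum_norm_xi_le (B : BakerDataG 𝓙 β γ δ) {D' : ℕ} (ξ : UIdx β γ δ D' → 𝓞 B.K) :
    ∑ u, ‖B.emb ((ξ u : 𝓞 B.K) : B.K)‖ ≤ Fintype.card (UIdx β γ δ D') * B.houseXi ξ := by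
  calc ∑ u, ‖B.emb ((ξ u : 𝓞 B.K) : B.K)‖ ≤ ∑ _u : UIdx β γ δ D', B.houseXi ξ :=
        Finset.sum_le_sum fun u _ => B.norm_embedding_xi_le ξ B.emb u
    _ = Fintype.card (UIdx β γ δ D') * B.houseXi ξ := by rw [Finset.sum_const, nsmul_eq_mul, Finset.card_univ]

/-- The size of the directions `X = ∑_m ‖x_m‖`. [folklore] -/
def dirNorm : ℝ := ∑ m, ‖B.xs m‖

omit [DecidableEq β] [DecidableEq δ] in
/-- `0 ≤ X`. [folklore] -/
theorem dirNorm_nonneg (B : BakerDataG 𝓙 β γ δ) : 0 ≤ B.dirNorm := Finset.sum_nonneg fun _ _ => norm_nonneg _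

omit [DecidableEq β] [DecidableEq δ] in
/-- `‖x_c‖ ≤ k · X` for `c_m ≤ k`. [folklore] -/
theorem norm_gridDir_le (B : BakerDataG 𝓙 β γ δ) {k : ℕ} {cg : Fin B.dd → ℕ} (hcg : ∀ m, cg m ≤ k) :
    ‖B.gridDir cg‖ ≤ k * B.dirNorm := by
  unfold gridDir dirNorm
  rw [Finset.mul_sum]
  refine (norm_sum_le _ _).trans (Finset.sum_le_sum fun m _ => ?_)
  rw [norm_smul, Complex.norm_natCast]
  exact mul_le_mul_of_nonneg_right (by exact_mod_cast hcg m) (norm_nonneg _)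


/-! ### The extrapolation estimate (scaled radius) -/

/-- **The extrapolation estimate with scaled radius** (`r = 1/(kX + 1)`): for `v ∈ 𝔟`,
vanishing to order `≥ T` along `𝔟` at `0, …, S₀v`, `c_m ≤ k`, `R ≥ 2(s + S₀)`, `R > 0`:
`|φ_{x_c,k}(s)| ≤ k!·(kX+1)^k·#U·H_ξ·e^{C(1+(R‖v‖+1)²)·D}·(2(s+S₀)/R)^{(T-k)(S₀+1)}`.
[cite: Baker1975, Ch. 2 Lemma 4; BakerWustholz2007, §6.8 (p. 119)] -/
theorem norm_extrapFun_grid_le₂ (B : BakerDataG 𝓙 β γ δ) {C : ℝ} (hC0 : 0 ≤ C)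
    (hC : ∀ (J : Option β × ThetaIdx γ δ) (w : β ⊕ (γ ⊕ δ) → ℂ),
      ‖theta B.L B.cls B.κM J w‖ ≤ Real.exp (C * (1 + ‖w‖ ^ 2)))
    (hv : B.v ∈ B.bSpan) {D' : ℕ} (ξ : UIdx β γ δ D' → 𝓞 B.K) {T S₀ : ℕ}
    (hvan : ∀ s₀ : ℕ, s₀ ≤ S₀ → VanishesAlong B.bSpan (thetaEval B.L B.cls B.κM (B.auxForm ξ)) ((s₀ : ℂ) • B.v) T)
    {k : ℕ} {cg : Fin B.dd → ℕ} (hcg : ∀ m, cg m ≤ k) (s : ℕ) {R : ℝ} (hR0 : 0 < R)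
    (hR : 2 * ((s : ℝ) + S₀) ≤ R) :
    ‖extrapFun B.L B.cls B.κM (B.auxForm ξ) B.v (B.gridDir cg) k s‖ ≤
      k.factorial * ((k : ℝ) * B.dirNorm + 1) ^ k * (Fintype.card (UIdx β γ δ D') * B.houseXi ξ *
        Real.exp (C * (1 + (R * ‖B.v‖ + 1) ^ 2)) ^ (Fintype.card (β ⊕ (γ ⊕ δ)) * D')) *
        (2 * ((s : ℝ) + S₀) / R) ^ ((T - k) * (S₀ + 1)) := by
  set D := Fintype.card (β ⊕ (γ ⊕ δ)) * D' with hD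
  set f := extrapFun B.L B.cls B.κM (B.auxForm ξ) B.v (B.gridDir cg) k with hf
  set r : ℝ := 1 / ((k : ℝ) * B.dirNorm + 1) with hr
  have hX0 := B.dirNorm_nonneg
  have hr0 : 0 < r := by rw [hr]; positivity
  have hrx : r * ‖B.gridDir cg‖ ≤ 1 := by
    have hX := B.norm_gridDir_le hcg
    rw [hr, one_div, inv_mul_le_iff₀ (by positivity)]
    linarith
  set pts : Finset ℂ := (Finset.range (S₀ + 1)).image (fun j : ℕ => (j : ℂ)) with hpts
  have hcard : pts.card = S₀ + 1 := by
    rw [hpts, Finset.card_image_of_injective _ Nat.cast_injective, Finset.card_range]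
  have hdiff : Differentiable ℂ f := differentiable_extrapFun B.L B.cls B.κM _ _ _ k
  have hord : ∀ c ∈ pts, ((T - k : ℕ) : ℕ∞) ≤ analyticOrderAt f c := by
    intro c hc
    obtain ⟨j, hj, rfl⟩ := Finset.mem_image.mp hc
    have hjS : j ≤ S₀ := Nat.lt_succ_iff.mp (Finset.mem_range.mp hj)
    exact le_analyticOrderAt_extrapFun B.L B.cls B.κM _ hv (B.gridDir_mem cg) (hvan j hjS) k
  -- the bound on the circle `|z| = R` with Cauchy radius `r` in `ξ`
  set θ : ℝ := k.factorial * (Nesterenko.l1Norm (B.auxForm ξ) *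
    Real.exp (C * (1 + (R * ‖B.v‖ + 1) ^ 2)) ^ D) / r ^ k with hθ
  have hθb : ∀ z ∈ sphere (0 : ℂ) R, ‖f z‖ ≤ θ := by
    intro z hz
    have hzR : ‖z‖ = R := by simpa using hz
    have h := norm_extrapFun_le_radius B.L B.cls B.κM hC0 hC (P := B.auxForm ξ) (D := D)
      ((isHomogeneous_homog D (B.QOf ξ)).totalDegree_le) B.v (B.gridDir cg) k z hr0
    rw [hzR] at h
    refine h.trans ?_
    rw [hθ]
    refine div_le_div_of_nonneg_right (mul_le_mul_of_nonneg_left (mul_le_mul_of_nonneg_left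
      (pow_le_pow_left₀ (Real.exp_nonneg _) (Real.exp_le_exp.mpr (mul_le_mul_of_nonneg_left ?_ hC0)) D)
      (Nesterenko.l1Norm_nonneg _)) (Nat.cast_nonneg _)) (pow_nonneg hr0.le _)
    have h1 : 0 ≤ R * ‖B.v‖ + r * ‖B.gridDir cg‖ := by positivity
    nlinarith
  -- separation and products as in `norm_extrapFun_grid_le`
  have hsep : ∀ z ∈ sphere (0 : ℂ) R, ∀ c ∈ pts, R / 2 ≤ ‖z - c‖ := by
    intro z hz c hc
    have hzR : ‖z‖ = R := by simpa using hz
    obtain ⟨j, hj, rfl⟩ := Finset.mem_image.mp hc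
    have hjS : (j : ℝ) ≤ S₀ := by exact_mod_cast Nat.lt_succ_iff.mp (Finset.mem_range.mp hj)
    have h1 : ‖z‖ - ‖(j : ℂ)‖ ≤ ‖z - (j : ℂ)‖ := norm_sub_norm_le z j
    rw [hzR, Complex.norm_natCast] at h1
    have hs0 : (0 : ℝ) ≤ s := Nat.cast_nonneg s
    linarith
  have hm : (0 : ℝ) < (R / 2) ^ ((T - k) * pts.card) := pow_pos (by linarith) _
  have hmF : ∀ z ∈ sphere (0 : ℂ) R, (R / 2) ^ ((T - k) * pts.card) ≤ ‖∏ c ∈ pts, (z - c) ^ (T - k)‖ :=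
    fun z hz => Baker1975.Analytic.le_norm_prod_pow pts (T - k) (by linarith) (hsep z hz)
  have hsR : ‖(s : ℂ)‖ ≤ R := by
    rw [Complex.norm_natCast]
    have : (0 : ℝ) ≤ S₀ := Nat.cast_nonneg S₀
    have hs0 : (0 : ℝ) ≤ s := Nat.cast_nonneg s
    linarith
  have hmain := Baker1975.Analytic.norm_le_of_analyticOrderAt hdiff pts (T - k) hord hR0 hθb hm hmF hsR
  have hup : ‖∏ c ∈ pts, ((s : ℂ) - c) ^ (T - k)‖ ≤ ((s : ℝ) + S₀) ^ ((T - k) * pts.card) := by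
    refine Baker1975.Analytic.norm_prod_pow_le pts (T - k) fun c hc => ?_
    obtain ⟨j, hj, rfl⟩ := Finset.mem_image.mp hc
    have hjS : (j : ℝ) ≤ S₀ := by exact_mod_cast Nat.lt_succ_iff.mp (Finset.mem_range.mp hj)
    calc ‖(s : ℂ) - (j : ℂ)‖ ≤ ‖(s : ℂ)‖ + ‖(j : ℂ)‖ := norm_sub_le _ _
      _ = s + j := by rw [Complex.norm_natCast, Complex.norm_natCast]
      _ ≤ s + S₀ := by linarith
  rw [hcard] at hm hup hmain
  have hθ0 : 0 ≤ θ := by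
    rw [hθ]; have := Nesterenko.l1Norm_nonneg (B.auxForm ξ); positivity
  have step1 : ‖f s‖ ≤ θ * (2 * ((s : ℝ) + S₀) / R) ^ ((T - k) * (S₀ + 1)) := by
    refine hmain.trans ?_
    have e : θ / (R / 2) ^ ((T - k) * (S₀ + 1)) * ((s : ℝ) + S₀) ^ ((T - k) * (S₀ + 1)) =
        θ * (2 * ((s : ℝ) + S₀) / R) ^ ((T - k) * (S₀ + 1)) := by
      rw [show 2 * ((s : ℝ) + S₀) / R = (2 / R) * ((s : ℝ) + S₀) from by ring, mul_pow, div_pow, div_pow]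
      field_simp
    rw [← e]
    exact mul_le_mul_of_nonneg_left hup (div_nonneg hθ0 hm.le)
  refine step1.trans (mul_le_mul_of_nonneg_right ?_ (by positivity))
  -- `θ ≤ k!·(kX+1)^k·#U·H_ξ·e^{…}`
  rw [hθ, hr, one_div, inv_pow, div_eq_mul_inv, inv_inv]
  have hcoeff := (B.l1Norm_homog_QOf_le ξ).trans (B.sum_norm_xi_le ξ)
  have hHξ := B.one_le_houseXi ξ
  have hE0 : 0 ≤ Real.exp (C * (1 + (R * ‖B.v‖ + 1) ^ 2)) ^ D := pow_nonneg (Real.exp_nonneg _) _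
  have hkX : 0 ≤ ((k : ℝ) * B.dirNorm + 1) ^ k := by positivity
  calc (k.factorial : ℝ) * (Nesterenko.l1Norm (B.auxForm ξ) * Real.exp (C * (1 + (R * ‖B.v‖ + 1) ^ 2)) ^ D) *
        ((k : ℝ) * B.dirNorm + 1) ^ k
      ≤ (k.factorial : ℝ) * ((Fintype.card (UIdx β γ δ D') * B.houseXi ξ) *
          Real.exp (C * (1 + (R * ‖B.v‖ + 1) ^ 2)) ^ D) * ((k : ℝ) * B.dirNorm + 1) ^ k := by
        refine mul_le_mul_of_nonneg_right (mul_le_mul_of_nonneg_left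
          (mul_le_mul_of_nonneg_right hcoeff hE0) (Nat.cast_nonneg _)) hkX
    _ = _ := by ring


end BakerDataG

end Std

end GaGmEFam

end Literature.NumberTheory.Transcendental

end

/-!
# Baker's method on `M_κ` at a general algebraic point: vanishing at the new points and the engine

Topic: `Literature/NumberTheory/Transcendental`. Unit
`provefact-Literature.NumberTheory.Transcendental.s-efcbe22610` (fact `semistabilityTheorem_std`).
Verbatim port to the general-point data `BakerDataG` (`BakerFieldG.lean` and sequels) of the
corresponding `BakerData` file(s) of the torsion-point chain (see the module docstring below the
imports of those files for the mathematics); the only changes are the shapes of the arithmetic of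
the point (`gBound s`, `d_s = d₁·pden s`) and of the lower bound for the base theta function
(`c·e^{−C(s+1)³}`). Everything is proved; no named facts.

## References

* A. Baker, G. Wüstholz, *Logarithmic Forms and Diophantine Geometry*, CUP 2007, §6.8 (pp. 118–119).
* A. Baker, *Transcendental Number Theory*, CUP 1975, Ch. 2, Lemmas 4–5.
-/

noncomputable section

open Complex Metric Set MvPolynomial Finset NumberField
open scoped PeriodPair

namespace Literature.NumberTheory.Transcendental

namespace GaGmEFam

namespace Std

open GaGmE (Kbar)
open GaGmE.Std (iy iz is coords coords_iy coords_iz coords_is sum_blocks ThetaIdx thetaT thetaT_none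
  thetaT_some differentiable_thetaT VanishesAlong isAlgebraic_coe_Kbar
  Gen factorGen zetaHat zetaHatDer factorODE zetaHatODE FactorChartValid isOpen_factorChartValid
  factorGen_false factorGen_true zetaHat_false zetaHat_true hasDerivAt_zetaHat
  baseFin baseIdx rPoly corrPoly TPoly rVal corrVal factor_blocks line_apply genFin genIdx
  rVal_baseFin corrVal_baseFin rVal_genFin genericChart affGen affIdx homog isHomogeneous_homog
  eval_homog_of_base_eq_one factorODEᵣ zetaHatODEᵣ rPolyᵣ corrPolyᵣ TPolyᵣ homogMonomialᵣ
  map_homogMonomialᵣ homog_monomial homog_add homog_zero homog_sum homog_eq_sum)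

namespace BakerDataG

open GaGmE.Std.BakerData (UIdx νOf νOf_apply νOf_injective degree_νOf_le card_UIdx lin_quad_le)

variable {𝓙 : Type} [Fintype 𝓙] [DecidableEq 𝓙] {β γ δ : Type} [Fintype β] [Fintype γ] [Fintype δ] [DecidableEq γ]
variable [DecidableEq β] [DecidableEq δ] (B : BakerDataG 𝓙 β γ δ)

/-! ### The constants of the lower bound -/

omit [DecidableEq β] [DecidableEq δ] in
/-- The lower bound for the base theta function at `s·v`, in terms of the adapted chart `cAt s`.
[cite: BakerWustholz2007, §6.8 (p. 119)] -/
theorem exists_theta_baseIdx_cAt_ge (B : BakerDataG 𝓙 β γ δ) : ∃ c : ℝ, 0 < c ∧ ∃ C : ℝ, 0 ≤ C ∧ ∀ s : ℕ,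
    c * Real.exp (-(C * ((s : ℝ) + 1) ^ 3)) ≤ ‖theta B.L B.cls B.κM (baseIdx (B.cAt s)) ((s : ℂ) • B.v)‖ :=
  B.exists_theta_baseIdx_ge

/-- **The constant `c_Θ > 0`** of the lower bound `c_Θ e^{-C'_Θ(s+1)³} ≤ |Θ_{J₀(c_s)}(s·v)|`. [folklore] -/
def thetaLowc : ℝ := B.exists_theta_baseIdx_cAt_ge.choose

/-- **The constant `C'_Θ ≥ 0`** of the lower bound. [folklore] -/
def thetaLowC : ℝ := B.exists_theta_baseIdx_cAt_ge.choose_spec.2.choose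

omit [DecidableEq β] [DecidableEq δ] in
/-- The defining properties of `c_Θ, C'_Θ`. [folklore] -/
theorem thetaLow_spec (B : BakerDataG 𝓙 β γ δ) : 0 < B.thetaLowc ∧ 0 ≤ B.thetaLowC ∧ ∀ s : ℕ,
    B.thetaLowc * Real.exp (-(B.thetaLowC * ((s : ℝ) + 1) ^ 3)) ≤
      ‖theta B.L B.cls B.κM (baseIdx (B.cAt s)) ((s : ℂ) • B.v)‖ :=
  ⟨B.exists_theta_baseIdx_cAt_ge.choose_spec.1, B.exists_theta_baseIdx_cAt_ge.choose_spec.2.choose_spec.1,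
    B.exists_theta_baseIdx_cAt_ge.choose_spec.2.choose_spec.2⟩

/-! ### The numerical condition and the vanishing at the new points -/

/-- **The numerical condition (scaled form)**: for all `s ≤ S₁`, `k < T'`,
`k!·(kX+1)^k·#U·H_ξ·e^{C_Θ(1+(R‖v‖+1)²)·D}·(2(s+S₀)/R)^{(T-k)(S₀+1)} · |d_s|^E (|d_s|^E Λ_{s,k})^{h-1}
  < (c_Θ e^{-C'_Θ(s+1)³})^{D}` (`D = nD'`). [folklore] -/
def NumCond₂ {D' : ℕ} (ξ : UIdx β γ δ D' → 𝓞 B.K) (T S₀ S₁ T' : ℕ) (R : ℝ) : Prop :=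
  ∀ s : ℕ, s ≤ S₁ → ∀ k : ℕ, k < T' →
    (k.factorial : ℝ) * ((k : ℝ) * B.dirNorm + 1) ^ k * (Fintype.card (UIdx β γ δ D') * B.houseXi ξ *
        Real.exp (thetaGrowthC (β := β) B.L B.cls B.κM * (1 + (R * ‖B.v‖ + 1) ^ 2)) ^
          (Fintype.card (β ⊕ (γ ⊕ δ)) * D')) *
      (2 * ((s : ℝ) + S₀) / R) ^ ((T - k) * (S₀ + 1)) *
      (|(B.dAt s : ℝ)| ^ B.expE (Fintype.card (β ⊕ (γ ⊕ δ)) * D') k *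
        (|(B.dAt s : ℝ)| ^ B.expE (Fintype.card (β ⊕ (γ ⊕ δ)) * D') k * B.lineValBound ξ s k) ^
          (B.gens.h - 1)) <
    (B.thetaLowc * Real.exp (-(B.thetaLowC * ((s : ℝ) + 1) ^ 3))) ^ (Fintype.card (β ⊕ (γ ⊕ δ)) * D')

/-- **Vanishing at the new points (scaled form).** [cite: BakerWustholz2007, §6.8 (p. 119)] -/
theorem vanishesAlong_newPoints₂ (B : BakerDataG 𝓙 β γ δ) (hv : B.v ∈ B.bSpan) {D' : ℕ} (ξ : UIdx β γ δ D' → 𝓞 B.K)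
    {T S₀ S₁ T' : ℕ} {R : ℝ} (hR0 : 0 < R) (hR : 2 * ((S₁ : ℝ) + S₀) ≤ R)
    (hvan : ∀ s₀ : ℕ, s₀ ≤ S₀ → VanishesAlong B.bSpan (thetaEval B.L B.cls B.κM (B.auxForm ξ)) ((s₀ : ℂ) • B.v) T)
    (hnum : B.NumCond₂ ξ T S₀ S₁ T' R) {s : ℕ} (hs : s ≤ S₁) :
    VanishesAlong B.bSpan (thetaEval B.L B.cls B.κM (B.auxForm ξ)) ((s : ℂ) • B.v) T' := by
  obtain ⟨hC0, hC⟩ := thetaGrowthC_spec (β := β) B.L B.cls B.κM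
  obtain ⟨hc0, hC'0, hlow⟩ := B.thetaLow_spec
  refine B.vanishesAlong_of_small ξ s T' fun k hk cg hcg => ?_
  have hRs : 2 * ((s : ℝ) + S₀) ≤ R := by
    have : (s : ℝ) ≤ S₁ := by exact_mod_cast hs
    linarith
  have hφ := B.norm_extrapFun_grid_le₂ hC0 hC hv ξ hvan hcg s hR0 hRs
  have hΛ : 0 ≤ |(B.dAt s : ℝ)| ^ B.expE (Fintype.card (β ⊕ (γ ⊕ δ)) * D') k *
      (|(B.dAt s : ℝ)| ^ B.expE (Fintype.card (β ⊕ (γ ⊕ δ)) * D') k * B.lineValBound ξ s k) ^ (B.gens.h - 1) := by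
    have := B.lineValBound_nonneg ξ s k
    positivity
  have hΘ : (B.thetaLowc * Real.exp (-(B.thetaLowC * ((s : ℝ) + 1) ^ 3))) ^ (Fintype.card (β ⊕ (γ ⊕ δ)) * D') ≤
      ‖theta B.L B.cls B.κM (baseIdx (B.cAt s)) ((s : ℂ) • B.v)‖ ^ (Fintype.card (β ⊕ (γ ⊕ δ)) * D') :=
    pow_le_pow_left₀ (by positivity) (hlow s) _
  calc ‖extrapFun B.L B.cls B.κM (B.auxForm ξ) B.v (B.gridDir cg) k s‖ *
        (|(B.dAt s : ℝ)| ^ B.expE (Fintype.card (β ⊕ (γ ⊕ δ)) * D') k *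
          (|(B.dAt s : ℝ)| ^ B.expE (Fintype.card (β ⊕ (γ ⊕ δ)) * D') k * B.lineValBound ξ s k) ^ (B.gens.h - 1))
      ≤ _ := mul_le_mul_of_nonneg_right hφ hΛ
    _ < _ := hnum s hs k hk
    _ ≤ _ := hΘ

/-- The Siegel house bound for the coefficients `ξ_u` (`SiegelWrapper.siegelConst`). [folklore] -/
def siegelHouseBound (D' T S₀ : ℕ) : ℝ :=
  siegelConst B.K * (siegelConst B.K * ((D' + 1) ^ Fintype.card (β ⊕ (γ ⊕ δ)) : ℕ) * B.houseBound D' T S₀) ^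
    ((((S₀ + 1) * T ^ B.dd : ℕ) : ℝ) /
      ((((D' + 1) ^ Fintype.card (β ⊕ (γ ⊕ δ)) : ℕ) : ℝ) - ((S₀ + 1) * T ^ B.dd : ℕ)))

/-- **The Baker engine (scaled form).** `v ∈ 𝔟`, `T ≥ 1`, `(S₀+1)·T^{dd} < (D'+1)^n`, `R > 0`,
`R ≥ 2(S₁ + S₀)`, and `NumCond₂` for every coefficient vector within the Siegel house bound
`⇒ ∃ P` homogeneous of degree `nD'`, `F_P ≢ 0`, `VanishesAlong 𝔟 F_P (s·v) T'` for `s ≤ S₁`.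
[cite: BakerWustholz2007, §6.8 (pp. 118–119)] -/
theorem engine₂ (B : BakerDataG 𝓙 β γ δ) (hv : B.v ∈ B.bSpan) (D' T S₀ S₁ T' : ℕ) (R : ℝ) (hT : 0 < T)
    (hpq : (S₀ + 1) * T ^ B.dd < (D' + 1) ^ Fintype.card (β ⊕ (γ ⊕ δ)))
    (hR0 : 0 < R) (hR : 2 * ((S₁ : ℝ) + S₀) ≤ R)
    (hnum : ∀ ξ : UIdx β γ δ D' → 𝓞 B.K,
      (∀ u, house ((ξ u : 𝓞 B.K) : B.K) ≤ B.siegelHouseBound D' T S₀) → B.NumCond₂ ξ T S₀ S₁ T' R) :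
    ∃ P : MvPolynomial (Option β × ThetaIdx γ δ) ℂ,
      P.IsHomogeneous (Fintype.card (β ⊕ (γ ⊕ δ)) * D') ∧
      (∃ w, thetaEval B.L B.cls B.κM P w ≠ 0) ∧
      ∀ s : ℕ, s ≤ S₁ → VanishesAlong B.bSpan (thetaEval B.L B.cls B.κM P) ((s : ℂ) • B.v) T' := by
  obtain ⟨ξ, -, hhouse, hne, hvan⟩ := B.exists_auxiliary₂ D' T S₀ hT hpq
  refine ⟨B.auxForm ξ, isHomogeneous_homog _ _, hne, fun s hs => ?_⟩
  exact B.vanishesAlong_newPoints₂ hv ξ hR0 hR (fun s₀ hs₀ => hvan s₀ hs₀) (hnum ξ hhouse) hs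


end BakerDataG

end Std

end GaGmEFam

end Literature.NumberTheory.Transcendental

end

/-!
# Two-base envelopes for the numerical condition at a general algebraic point

Topic: `Literature/NumberTheory/Transcendental`. Unit
`provefact-Literature.NumberTheory.Transcendental.s-efcbe22610` (fact `semistabilityTheorem_std`).
`NumCondEnvelopes.lean` for the general-point data `BakerDataG`: every factor of the left-hand
side of `NewPointsG.NumCond₂` is bounded by `G^{N₁} · W^{N₂}` with natural exponents, where
`G = bigConst` dominates all constants of the datum (now including the base `Mg` of the conjugate
bounds `gBound s = Mg^{(s+1)³}`) and `W ≥ 1` the linear sizes. Compared with the torsion-point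
file the `s`-dependence is cubic: `gBound s ≤ G^{(s+1)³}`, `dB s ≤ G^{1 + #Gen·(s+1)³}`
(`houseBound_le`, `dAt_pow_le`, `lineValBound_le`) and `G^{-D(1+(s+1)³)} ≤ (c_Θ e^{-C'_Θ(s+1)³})^D`
(`rhs_ge`); `siegelHouseBound_le`, `houseXi_le`, `orderLoss_le`, `growth_le` are verbatim and
the generic `BakerData.saving_le`, `GaGmE.Std.BakerData.rpow_le_self_of_one_le` are reused.
Everything is proved; no named facts.

## References

* A. Baker, G. Wüstholz, *Logarithmic Forms and Diophantine Geometry*, CUP 2007, §6.8 (p. 119).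
-/

noncomputable section

open Complex MvPolynomial Finset NumberField
open scoped PeriodPair

namespace Literature.NumberTheory.Transcendental

namespace GaGmEFam

namespace Std

open GaGmE (Kbar)
open GaGmE.Std (iy iz is coords coords_iy coords_iz coords_is sum_blocks ThetaIdx thetaT thetaT_none
  thetaT_some differentiable_thetaT VanishesAlong isAlgebraic_coe_Kbar
  Gen factorGen zetaHat zetaHatDer factorODE zetaHatODE FactorChartValid isOpen_factorChartValid
  factorGen_false factorGen_true zetaHat_false zetaHat_true hasDerivAt_zetaHat
  baseFin baseIdx rPoly corrPoly TPoly rVal corrVal factor_blocks line_apply genFin genIdx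
  rVal_baseFin corrVal_baseFin rVal_genFin genericChart affGen affIdx homog isHomogeneous_homog
  eval_homog_of_base_eq_one factorODEᵣ zetaHatODEᵣ rPolyᵣ corrPolyᵣ TPolyᵣ homogMonomialᵣ
  map_homogMonomialᵣ homog_monomial homog_add homog_zero homog_sum homog_eq_sum)

namespace BakerDataG

open GaGmE.Std.BakerData (UIdx νOf νOf_apply νOf_injective degree_νOf_le card_UIdx lin_quad_le)

variable {𝓙 : Type} [Fintype 𝓙] [DecidableEq 𝓙] {β γ δ : Type} [Fintype β] [Fintype γ] [Fintype δ] [DecidableEq γ]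
variable (B : BakerDataG 𝓙 β γ δ)

/-! ### The big constant -/

/-- **The big constant** `G ≥ 2` dominating every constant of the datum that enters `NumCond₂`.
[folklore] -/
def bigConst : ℝ :=
  2 + |(B.d₁ : ℝ)| + B.Mg + B.hB + max 1 B.qB + ((B.dd : ℝ) + 1) + siegelConst B.K +
    Real.exp (thetaGrowthC (β := β) B.L B.cls B.κM) + B.thetaLowc⁻¹ + Real.exp B.thetaLowC +
    (B.dirNorm + 1) + (‖B.v‖ + 1)

/-- The summands of `G` are non-negative; `G` dominates each of them and `G ≥ 2`. [folklore] -/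
theorem bigConst_spec (B : BakerDataG 𝓙 β γ δ) :
    2 ≤ B.bigConst ∧ |(B.d₁ : ℝ)| ≤ B.bigConst ∧ B.Mg ≤ B.bigConst ∧ B.hB ≤ B.bigConst ∧
    max 1 B.qB ≤ B.bigConst ∧ (B.dd : ℝ) + 1 ≤ B.bigConst ∧ siegelConst B.K ≤ B.bigConst ∧
    Real.exp (thetaGrowthC (β := β) B.L B.cls B.κM) ≤ B.bigConst ∧ B.thetaLowc⁻¹ ≤ B.bigConst ∧
    Real.exp B.thetaLowC ≤ B.bigConst ∧ B.dirNorm + 1 ≤ B.bigConst ∧ ‖B.v‖ + 1 ≤ B.bigConst := by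
  have h1 : 0 ≤ |(B.d₁ : ℝ)| := abs_nonneg _
  have h2 : 0 ≤ B.Mg := zero_le_one.trans B.one_le_Mg
  have h3 : 0 ≤ B.hB := zero_le_one.trans B.one_le_hB
  have h4 : 0 ≤ max 1 B.qB := zero_le_one.trans (le_max_left _ _)
  have h5 : 0 ≤ (B.dd : ℝ) + 1 := by positivity
  have h6 : 0 ≤ siegelConst B.K := zero_le_one.trans (one_le_siegelConst B.K)
  have h7 : 0 ≤ Real.exp (thetaGrowthC (β := β) B.L B.cls B.κM) := Real.exp_nonneg _
  have h8 : 0 ≤ B.thetaLowc⁻¹ := inv_nonneg.mpr B.thetaLow_spec.1.le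
  have h9 : 0 ≤ Real.exp B.thetaLowC := Real.exp_nonneg _
  have h10 : 0 ≤ B.dirNorm + 1 := by have := B.dirNorm_nonneg; positivity
  have h11 : 0 ≤ ‖B.v‖ + 1 := by positivity
  unfold bigConst
  refine ⟨?_, ?_, ?_, ?_, ?_, ?_, ?_, ?_, ?_, ?_, ?_, ?_⟩ <;> linarith

/-- `1 ≤ G`. [folklore] -/
theorem one_le_bigConst (B : BakerDataG 𝓙 β γ δ) : 1 ≤ B.bigConst := by have := B.bigConst_spec.1; linarith

/-! ### Elementary envelope tools -/

/-- `x^N ≤ G^N` for `0 ≤ x ≤ G`. [folklore] -/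
theorem pow_le_bigConst_pow (B : BakerDataG 𝓙 β γ δ) {x : ℝ} (hx0 : 0 ≤ x) (hx : x ≤ B.bigConst) (N : ℕ) : x ^ N ≤ B.bigConst ^ N :=
  pow_le_pow_left₀ hx0 hx N

/-- Monotonicity in the exponent: `G^N ≤ G^{N'}` for `N ≤ N'`. [folklore] -/
theorem bigConst_pow_mono (B : BakerDataG 𝓙 β γ δ) {N N' : ℕ} (h : N ≤ N') : B.bigConst ^ N ≤ B.bigConst ^ N' :=
  pow_le_pow_right₀ B.one_le_bigConst h

/-- `exp(C·y) ≤ G^N` when `e^C ≤ G`, `0 ≤ y ≤ N`. [folklore] -/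
theorem exp_mul_le_bigConst_pow (B : BakerDataG 𝓙 β γ δ) {C y : ℝ} (hC : Real.exp C ≤ B.bigConst) (hC0 : 0 ≤ C)
    {N : ℕ} (hy : y ≤ N) : Real.exp (C * y) ≤ B.bigConst ^ N := by
  have hG := B.one_le_bigConst
  calc Real.exp (C * y) ≤ Real.exp (C * N) := Real.exp_le_exp.mpr (mul_le_mul_of_nonneg_left hy hC0)
    _ = Real.exp C ^ N := by rw [← Real.exp_nat_mul, mul_comm]
    _ ≤ B.bigConst ^ N := pow_le_pow_left₀ (Real.exp_nonneg _) hC N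

/-! ### The house bound -/

/-- `gBound s ≤ G^{(s+1)³}`. [folklore] -/
theorem gBound_le_pow (B : BakerDataG 𝓙 β γ δ) (s : ℕ) : B.gBound s ≤ B.bigConst ^ ((s + 1) ^ 3) :=
  pow_le_pow_left₀ (zero_le_one.trans B.one_le_Mg) B.bigConst_spec.2.2.1 _

/-- `dB s ≤ G^{1 + #Gen·(s+1)³}`. [folklore] -/
theorem dB_le_pow (B : BakerDataG 𝓙 β γ δ) (s : ℕ) : B.dB s ≤ B.bigConst ^ (1 + Fintype.card (Gen β γ δ) * (s + 1) ^ 3) := by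
  obtain ⟨hG2, hd1, -⟩ := B.bigConst_spec
  unfold dB
  rw [pow_add, pow_one, pow_mul]
  have h0 : (0 : ℝ) ≤ B.gBound s ^ Fintype.card (Gen β γ δ) := pow_nonneg (zero_le_one.trans (B.one_le_gBound s)) _
  refine mul_le_mul hd1 ?_ h0 (by linarith)
  rw [← pow_mul, mul_comm, pow_mul]
  exact pow_le_pow_left₀ (zero_le_one.trans (B.one_le_gBound s)) (B.gBound_le_pow s) _

/-- **Envelope of `houseBound`**: with `D = nD'`, `E_T = expE D T`, `c = #Gen`,
`A ≤ G^{(1 + c(S₀+1)³)E_T + 2T + D + (S₀+1)³(D·hdeg + 2T)} · W^{T}`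
whenever `D·hdeg + 2T + 1 ≤ W`. [folklore] -/
theorem houseBound_le (B : BakerDataG 𝓙 β γ δ) (D' T S₀ : ℕ) {W : ℝ} (hW1 : 1 ≤ W)
    (hWT : ((Fintype.card (β ⊕ (γ ⊕ δ)) * D' * B.hdeg : ℕ) : ℝ) + 2 * T + 1 ≤ W) :
    B.houseBound D' T S₀ ≤
      B.bigConst ^ ((1 + Fintype.card (Gen β γ δ) * (S₀ + 1) ^ 3) * B.expE (Fintype.card (β ⊕ (γ ⊕ δ)) * D') T + 2 * T +
          Fintype.card (β ⊕ (γ ⊕ δ)) * D' +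
          (S₀ + 1) ^ 3 * (Fintype.card (β ⊕ (γ ⊕ δ)) * D' * B.hdeg + 2 * T)) *
        W ^ T := by
  obtain ⟨hG2, hd1, hM, hhB, hqB, hdd, -⟩ := B.bigConst_spec
  have hG1 := B.one_le_bigConst
  set n := Fintype.card (β ⊕ (γ ⊕ δ)) with hn
  set cG := Fintype.card (Gen β γ δ) with hcG
  set D := n * D' with hD
  set ET := B.expE D T with hET
  set P := D * B.hdeg + 2 * T with hP
  unfold houseBound
  rw [← hn, ← hD, ← hET]
  have hG0 : (0 : ℝ) ≤ B.bigConst := by linarith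
  have hW0 : (0 : ℝ) ≤ W := by linarith
  have hdB1 := B.one_le_dB S₀
  have hgB1 := B.one_le_gBound S₀
  -- factor by factor
  have f1 : B.dB S₀ ^ ET ≤ (B.bigConst ^ (1 + cG * (S₀ + 1) ^ 3)) ^ ET :=
    pow_le_pow_left₀ (zero_le_one.trans hdB1) (B.dB_le_pow S₀) _
  have f2 : ((B.dd : ℝ) + 1) ^ T ≤ B.bigConst ^ T := pow_le_pow_left₀ (by positivity) hdd _
  have f3 : (((D * B.hdeg : ℕ) : ℝ) + 2 * T + 1) ^ T ≤ W ^ T := pow_le_pow_left₀ (by positivity) hWT _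
  have f4 : (max 1 B.qB) ^ T ≤ B.bigConst ^ T := pow_le_pow_left₀ (zero_le_one.trans (le_max_left _ _)) hqB _
  have f5 : B.hB ^ D ≤ B.bigConst ^ D := pow_le_pow_left₀ (zero_le_one.trans B.one_le_hB) hhB _
  have f6 : B.gBound S₀ ^ P ≤ (B.bigConst ^ ((S₀ + 1) ^ 3)) ^ P :=
    pow_le_pow_left₀ (zero_le_one.trans hgB1) (B.gBound_le_pow S₀) _
  have n2 : (0 : ℝ) ≤ ((B.dd : ℝ) + 1) ^ T := by positivity
  have n3 : (0 : ℝ) ≤ (((D * B.hdeg : ℕ) : ℝ) + 2 * T + 1) ^ T := by positivity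
  have n4 : (0 : ℝ) ≤ (max 1 B.qB) ^ T := pow_nonneg (zero_le_one.trans (le_max_left _ _)) _
  have n5 : (0 : ℝ) ≤ B.hB ^ D := pow_nonneg (zero_le_one.trans B.one_le_hB) _
  have n6 : (0 : ℝ) ≤ B.gBound S₀ ^ P := pow_nonneg (zero_le_one.trans hgB1) _
  have b1 : (0 : ℝ) ≤ (B.bigConst ^ (1 + cG * (S₀ + 1) ^ 3)) ^ ET := by positivity
  calc B.dB S₀ ^ ET * ((B.dd : ℝ) + 1) ^ T * (((D * B.hdeg : ℕ) : ℝ) + 2 * T + 1) ^ T *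
        (max 1 B.qB) ^ T * B.hB ^ D * B.gBound S₀ ^ P
      ≤ (B.bigConst ^ (1 + cG * (S₀ + 1) ^ 3)) ^ ET * B.bigConst ^ T * W ^ T * B.bigConst ^ T * B.bigConst ^ D *
          (B.bigConst ^ ((S₀ + 1) ^ 3)) ^ P :=
        mul_le_mul (mul_le_mul (mul_le_mul (mul_le_mul (mul_le_mul f1 f2 n2 b1) f3 n3 (by positivity)) f4 n4
          (by positivity)) f5 n5 (by positivity)) f6 n6 (by positivity)
    _ = B.bigConst ^ ((1 + cG * (S₀ + 1) ^ 3) * ET + 2 * T + D + (S₀ + 1) ^ 3 * P) * W ^ T := by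
        rw [← pow_mul, ← pow_mul]; ring

/-! ### The Siegel house bound and `H_ξ` -/

/-- **Envelope of the Siegel house bound** when `q ≥ 2p` (so the Siegel exponent is `≤ 1`):
`siegelHouseBound ≤ G² · W^n · A`, `A = houseBound`, given `(D'+1)^n ≤ W^n`-type control
`D' + 1 ≤ W`. [folklore] -/
theorem siegelHouseBound_le (B : BakerDataG 𝓙 β γ δ) (D' T S₀ : ℕ) {W : ℝ} (hWD : (D' : ℝ) + 1 ≤ W)
    (hqp : 2 * ((S₀ + 1) * T ^ B.dd) ≤ (D' + 1) ^ Fintype.card (β ⊕ (γ ⊕ δ))) (hp : 0 < (S₀ + 1) * T ^ B.dd) :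
    B.siegelHouseBound D' T S₀ ≤ B.bigConst ^ 2 * W ^ Fintype.card (β ⊕ (γ ⊕ δ)) * B.houseBound D' T S₀ := by
  obtain ⟨hG2, -, -, -, -, -, hCK, -⟩ := B.bigConst_spec
  set n := Fintype.card (β ⊕ (γ ⊕ δ)) with hn
  set p : ℕ := (S₀ + 1) * T ^ B.dd with hp'
  set q : ℕ := (D' + 1) ^ n with hq
  have hA1 := B.one_le_houseBound D' T S₀
  have hC1 := one_le_siegelConst B.K
  have hq1 : (1 : ℝ) ≤ q := by
    have : 1 ≤ q := Nat.one_le_iff_ne_zero.mpr (pow_ne_zero _ (Nat.succ_ne_zero _))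
    exact_mod_cast this
  -- the exponent `t = p/(q - p) ∈ [0, 1]`
  have hqp' : (2 : ℝ) * p ≤ q := by exact_mod_cast hqp
  have hp0 : (0 : ℝ) < p := by exact_mod_cast hp
  set t : ℝ := (p : ℝ) / ((q : ℝ) - p) with ht
  have ht1 : t ≤ 1 := by rw [ht, div_le_one (by linarith)]; linarith
  have hbase : 1 ≤ siegelConst B.K * q * B.houseBound D' T S₀ :=
    one_le_mul_of_one_le_of_one_le (one_le_mul_of_one_le_of_one_le hC1 hq1) hA1
  unfold siegelHouseBound
  rw [← hn, ← hp', ← hq]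
  calc siegelConst B.K * (siegelConst B.K * (q : ℝ) * B.houseBound D' T S₀) ^ t
      ≤ siegelConst B.K * (siegelConst B.K * (q : ℝ) * B.houseBound D' T S₀) :=
        mul_le_mul_of_nonneg_left (GaGmE.Std.BakerData.rpow_le_self_of_one_le hbase ht1) (zero_le_one.trans hC1)
    _ = siegelConst B.K ^ 2 * (q : ℝ) * B.houseBound D' T S₀ := by ring
    _ ≤ B.bigConst ^ 2 * W ^ n * B.houseBound D' T S₀ := by
        have hqW : (q : ℝ) ≤ W ^ n := by
          rw [hq]; push_cast; exact pow_le_pow_left₀ (by positivity) hWD n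
        have hCG : siegelConst B.K ^ 2 ≤ B.bigConst ^ 2 := pow_le_pow_left₀ (zero_le_one.trans hC1) hCK 2
        have : (0 : ℝ) ≤ B.bigConst ^ 2 := by positivity
        exact mul_le_mul_of_nonneg_right (mul_le_mul hCG hqW (by positivity) this) (zero_le_one.trans hA1)

variable [DecidableEq β] [DecidableEq δ]

/-- **Envelope of `H_ξ`** under the Siegel house bound on the coefficients:
`H_ξ ≤ G³ · W^{2n} · A`. [folklore] -/
theorem houseXi_le (B : BakerDataG 𝓙 β γ δ) {D' T S₀ : ℕ} (ξ : UIdx β γ δ D' → 𝓞 B.K)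
    (hξ : ∀ u, house ((ξ u : 𝓞 B.K) : B.K) ≤ B.siegelHouseBound D' T S₀) {W : ℝ} (hW1 : 1 ≤ W)
    (hWD : (D' : ℝ) + 1 ≤ W) (hqp : 2 * ((S₀ + 1) * T ^ B.dd) ≤ (D' + 1) ^ Fintype.card (β ⊕ (γ ⊕ δ)))
    (hp : 0 < (S₀ + 1) * T ^ B.dd) :
    B.houseXi ξ ≤ B.bigConst ^ 3 * W ^ (2 * Fintype.card (β ⊕ (γ ⊕ δ))) * B.houseBound D' T S₀ := by
  have hG2 := B.bigConst_spec.1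
  set n := Fintype.card (β ⊕ (γ ⊕ δ)) with hn
  have hSHB := B.siegelHouseBound_le D' T S₀ hWD hqp hp
  rw [← hn] at hSHB
  have hA1 := B.one_le_houseBound D' T S₀
  have hU : (Fintype.card (UIdx β γ δ D') : ℝ) ≤ W ^ n := by
    rw [card_UIdx]; push_cast; exact pow_le_pow_left₀ (by positivity) hWD n
  unfold houseXi
  have hsum : ∑ u, house ((ξ u : 𝓞 B.K) : B.K) ≤ (Fintype.card (UIdx β γ δ D') : ℝ) * B.siegelHouseBound D' T S₀ := by
    calc ∑ u, house ((ξ u : 𝓞 B.K) : B.K) ≤ ∑ _u : UIdx β γ δ D', B.siegelHouseBound D' T S₀ :=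
          Finset.sum_le_sum fun u _ => hξ u
      _ = _ := by rw [Finset.sum_const, nsmul_eq_mul, Finset.card_univ]
  have hSHB0 : 0 ≤ B.siegelHouseBound D' T S₀ := (house_nonneg _).trans (hξ (fun _ => 0))
  have hWn : (1 : ℝ) ≤ W ^ n := one_le_pow₀ hW1
  have hX : 1 + (Fintype.card (UIdx β γ δ D') : ℝ) * B.siegelHouseBound D' T S₀ ≤
      W ^ n * (B.bigConst ^ 2 * W ^ n * B.houseBound D' T S₀) + W ^ n * (B.bigConst ^ 2 * W ^ n * B.houseBound D' T S₀) := by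
    have h1 : (1 : ℝ) ≤ W ^ n * (B.bigConst ^ 2 * W ^ n * B.houseBound D' T S₀) := by
      refine one_le_mul_of_one_le_of_one_le hWn (one_le_mul_of_one_le_of_one_le
        (one_le_mul_of_one_le_of_one_le (by nlinarith) hWn) hA1)
    have h2 : (Fintype.card (UIdx β γ δ D') : ℝ) * B.siegelHouseBound D' T S₀ ≤
        W ^ n * (B.bigConst ^ 2 * W ^ n * B.houseBound D' T S₀) :=
      mul_le_mul hU hSHB hSHB0 (by positivity)
    linarith
  calc 1 + ∑ u, house ((ξ u : 𝓞 B.K) : B.K) ≤ 1 + (Fintype.card (UIdx β γ δ D') : ℝ) * B.siegelHouseBound D' T S₀ := by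
        linarith
    _ ≤ 2 * (W ^ n * (B.bigConst ^ 2 * W ^ n * B.houseBound D' T S₀)) := by linarith
    _ ≤ B.bigConst * (W ^ n * (B.bigConst ^ 2 * W ^ n * B.houseBound D' T S₀)) :=
        mul_le_mul_of_nonneg_right hG2 (by positivity)
    _ = B.bigConst ^ 3 * W ^ (2 * n) * B.houseBound D' T S₀ := by ring

/-! ### Denominators, the order loss, the growth factor, the right-hand side -/

omit [DecidableEq β] [DecidableEq δ] in
/-- **Envelope of `|d_s|^E`**: `|d_s|^{E(D,k)} ≤ G^{(1 + #Gen·(S₁+1)³)·E(D,T')}` for `s ≤ S₁`, `k ≤ T'`.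
[folklore] -/
theorem dAt_pow_le (B : BakerDataG 𝓙 β γ δ) {D S₁ T' s k : ℕ} (hs : s ≤ S₁) (hk : k ≤ T') :
    |(B.dAt s : ℝ)| ^ B.expE D k ≤ B.bigConst ^ ((1 + Fintype.card (Gen β γ δ) * (S₁ + 1) ^ 3) * B.expE D T') := by
  have hG1 := B.one_le_bigConst
  have h1 : |(B.dAt s : ℝ)| ≤ B.bigConst ^ (1 + Fintype.card (Gen β γ δ) * (S₁ + 1) ^ 3) :=
    ((B.abs_dAt_le_dB s).trans (B.dB_mono hs)).trans (B.dB_le_pow S₁)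
  calc |(B.dAt s : ℝ)| ^ B.expE D k ≤ (B.bigConst ^ (1 + Fintype.card (Gen β γ δ) * (S₁ + 1) ^ 3)) ^ B.expE D k :=
        pow_le_pow_left₀ (abs_nonneg _) h1 _
    _ ≤ (B.bigConst ^ (1 + Fintype.card (Gen β γ δ) * (S₁ + 1) ^ 3)) ^ B.expE D T' :=
        pow_le_pow_right₀ (one_le_pow₀ hG1) (B.expE_mono D hk)
    _ = _ := by rw [← pow_mul]

omit [DecidableEq β] [DecidableEq δ] in
/-- **Envelope of the order loss** `k!·(kX+1)^k ≤ (G·W)^{2T'}` for `k ≤ T' ≤ W`. [folklore] -/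
theorem orderLoss_le (B : BakerDataG 𝓙 β γ δ) {T' k : ℕ} (hk : k ≤ T') {W : ℝ} (hW1 : 1 ≤ W) (hWT : (T' : ℝ) ≤ W) :
    (k.factorial : ℝ) * ((k : ℝ) * B.dirNorm + 1) ^ k ≤ (B.bigConst * W) ^ (2 * T') := by
  obtain ⟨hG2, -, -, -, -, -, -, -, -, -, hX, -⟩ := B.bigConst_spec
  have hX0 := B.dirNorm_nonneg
  have hG1 := B.one_le_bigConst
  have hGW1 : 1 ≤ B.bigConst * W := one_le_mul_of_one_le_of_one_le hG1 hW1
  have hkW : (k : ℝ) ≤ W := le_trans (by exact_mod_cast hk) hWT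
  -- `k! ≤ k^k ≤ W^k`
  have h1 : (k.factorial : ℝ) ≤ W ^ k := by
    calc (k.factorial : ℝ) ≤ ((k ^ k : ℕ) : ℝ) := by exact_mod_cast Nat.factorial_le_pow k
      _ = (k : ℝ) ^ k := by push_cast; ring
      _ ≤ W ^ k := pow_le_pow_left₀ (Nat.cast_nonneg _) hkW k
  -- `kX + 1 ≤ W·G`
  have h2 : (k : ℝ) * B.dirNorm + 1 ≤ B.bigConst * W := by
    have : (k : ℝ) * B.dirNorm + 1 ≤ W * (B.dirNorm + 1) := by nlinarith
    calc (k : ℝ) * B.dirNorm + 1 ≤ W * (B.dirNorm + 1) := this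
      _ ≤ W * B.bigConst := mul_le_mul_of_nonneg_left hX (by linarith)
      _ = B.bigConst * W := mul_comm _ _
  calc (k.factorial : ℝ) * ((k : ℝ) * B.dirNorm + 1) ^ k ≤ W ^ k * (B.bigConst * W) ^ k :=
        mul_le_mul h1 (pow_le_pow_left₀ (by positivity) h2 k) (by positivity) (by positivity)
    _ ≤ (B.bigConst * W) ^ k * (B.bigConst * W) ^ k := by
        refine mul_le_mul_of_nonneg_right (pow_le_pow_left₀ (by linarith) ?_ k) (by positivity)
        nlinarith
    _ = (B.bigConst * W) ^ (2 * k) := by rw [← pow_add]; ring_nf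
    _ ≤ (B.bigConst * W) ^ (2 * T') := pow_le_pow_right₀ hGW1 (by omega)

omit [DecidableEq β] [DecidableEq δ] in
/-- **Envelope of the growth factor**: with `R ≤ R'` (`R' ∈ ℕ`), `e^{C_Θ D (1 + (R‖v‖+1)²)} ≤ G^{D(1 + (R'+1)² G'²)}`
where `G ≤ G'` (`G' ∈ ℕ`). [folklore] -/
theorem growth_le (B : BakerDataG 𝓙 β γ δ) (D : ℕ) {R : ℝ} (hR0 : 0 ≤ R) {R' G' : ℕ} (hR : R ≤ R') (hG' : B.bigConst ≤ G') :
    Real.exp (thetaGrowthC (β := β) B.L B.cls B.κM * (1 + (R * ‖B.v‖ + 1) ^ 2)) ^ D ≤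
      B.bigConst ^ (D * (1 + (R' + 1) ^ 2 * G' ^ 2)) := by
  obtain ⟨hG2, -, -, -, -, -, -, hexp, -, -, -, hv⟩ := B.bigConst_spec
  have hC0 := (thetaGrowthC_spec (β := β) B.L B.cls B.κM).1
  have hv0 : 0 ≤ ‖B.v‖ := norm_nonneg _
  have hin : R * ‖B.v‖ + 1 ≤ ((R' : ℝ) + 1) * B.bigConst := by
    have h1 : R * ‖B.v‖ + 1 ≤ (R + 1) * (‖B.v‖ + 1) := by nlinarith
    calc R * ‖B.v‖ + 1 ≤ (R + 1) * (‖B.v‖ + 1) := h1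
      _ ≤ ((R' : ℝ) + 1) * B.bigConst := mul_le_mul (by linarith) hv (by positivity) (by positivity)
  have hsq : (R * ‖B.v‖ + 1) ^ 2 ≤ (((R' : ℝ) + 1) * G') ^ 2 := by
    refine pow_le_pow_left₀ (by positivity) (hin.trans ?_) 2
    exact mul_le_mul_of_nonneg_left hG' (by positivity)
  have hy : 1 + (R * ‖B.v‖ + 1) ^ 2 ≤ ((1 + (R' + 1) ^ 2 * G' ^ 2 : ℕ) : ℝ) := by
    push_cast; nlinarith
  rw [← Real.exp_nat_mul]
  rw [show (D : ℝ) * (thetaGrowthC (β := β) B.L B.cls B.κM * (1 + (R * ‖B.v‖ + 1) ^ 2)) =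
      thetaGrowthC (β := β) B.L B.cls B.κM * ((D : ℝ) * (1 + (R * ‖B.v‖ + 1) ^ 2)) from by ring]
  refine B.exp_mul_le_bigConst_pow hexp hC0 ?_
  push_cast
  exact mul_le_mul_of_nonneg_left (by exact_mod_cast hy) (Nat.cast_nonneg D)

omit [DecidableEq β] [DecidableEq δ] in
/-- **Lower envelope of the right-hand side**: `G^{-D(1+(s+1)³)} ≤ (c_Θ e^{-C'_Θ(s+1)³})^D`. [folklore] -/
theorem rhs_ge (B : BakerDataG 𝓙 β γ δ) (D s : ℕ) :
    (B.bigConst ^ (D * (1 + (s + 1) ^ 3)))⁻¹ ≤ (B.thetaLowc * Real.exp (-(B.thetaLowC * ((s : ℝ) + 1) ^ 3))) ^ D := by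
  obtain ⟨hG2, -, -, -, -, -, -, -, hcinv, hCexp, -⟩ := B.bigConst_spec
  obtain ⟨hc0, hC'0, -⟩ := B.thetaLow_spec
  have hG1 := B.one_le_bigConst
  have hG0 : 0 < B.bigConst := by linarith
  have h1 : B.bigConst⁻¹ ≤ B.thetaLowc := by
    rw [inv_le_comm₀ hG0 hc0]; exact hcinv
  have h2 : (B.bigConst ^ ((s + 1) ^ 3))⁻¹ ≤ Real.exp (-(B.thetaLowC * ((s : ℝ) + 1) ^ 3)) := by
    rw [Real.exp_neg, inv_le_inv₀ (by positivity) (Real.exp_pos _)]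
    calc Real.exp (B.thetaLowC * ((s : ℝ) + 1) ^ 3) = Real.exp B.thetaLowC ^ ((s + 1) ^ 3) := by
          rw [← Real.exp_nat_mul]; push_cast; ring_nf
      _ ≤ B.bigConst ^ ((s + 1) ^ 3) := pow_le_pow_left₀ (Real.exp_nonneg _) hCexp _
  calc (B.bigConst ^ (D * (1 + (s + 1) ^ 3)))⁻¹ = (B.bigConst⁻¹ * (B.bigConst ^ ((s + 1) ^ 3))⁻¹) ^ D := by
        rw [← mul_inv, ← pow_succ', inv_pow, ← pow_mul]
        congr 2; ring
    _ ≤ (B.thetaLowc * Real.exp (-(B.thetaLowC * ((s : ℝ) + 1) ^ 3))) ^ D :=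
        pow_le_pow_left₀ (by positivity) (mul_le_mul h1 h2 (by positivity) hc0.le) D

/-! ### The Liouville bound `Λ` and the saving factor -/

/-- **Envelope of `lineValBound`**: for `s ≤ S₁`, `k ≤ T'`, under the Siegel house bound,
`Λ_{s,k} ≤ G^{2T' + 3 + D + (S₁+1)³P₁} · W^{2T' + 3n} · A`, `P₁ = D·hdeg + 2T'`, `A = houseBound`.
[folklore] -/
theorem lineValBound_le (B : BakerDataG 𝓙 β γ δ) {D' T S₀ S₁ T' : ℕ} (ξ : UIdx β γ δ D' → 𝓞 B.K)
    (hξ : ∀ u, house ((ξ u : 𝓞 B.K) : B.K) ≤ B.siegelHouseBound D' T S₀) {W : ℝ} (hW1 : 1 ≤ W)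
    (hWD : (D' : ℝ) + 1 ≤ W) (hqp : 2 * ((S₀ + 1) * T ^ B.dd) ≤ (D' + 1) ^ Fintype.card (β ⊕ (γ ⊕ δ)))
    (hp : 0 < (S₀ + 1) * T ^ B.dd) (hWT' : (T' : ℝ) ≤ W)
    (hWP : ((Fintype.card (β ⊕ (γ ⊕ δ)) * D' * B.hdeg : ℕ) : ℝ) + 2 * T' ≤ W)
    {s k : ℕ} (hs : s ≤ S₁) (hk : k ≤ T') :
    B.lineValBound ξ s k ≤
      B.bigConst ^ (2 * T' + 3 + Fintype.card (β ⊕ (γ ⊕ δ)) * D' +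
          (S₁ + 1) ^ 3 * (Fintype.card (β ⊕ (γ ⊕ δ)) * D' * B.hdeg + 2 * T')) *
        W ^ (2 * T' + 3 * Fintype.card (β ⊕ (γ ⊕ δ))) * B.houseBound D' T S₀ := by
  obtain ⟨hG2, -, hM, hhB, hqB, hdd, -⟩ := B.bigConst_spec
  have hG1 := B.one_le_bigConst
  have hG0 : (0 : ℝ) ≤ B.bigConst := by linarith
  have hW0 : (0 : ℝ) ≤ W := by linarith
  set n := Fintype.card (β ⊕ (γ ⊕ δ)) with hn
  set D := n * D' with hD
  set P₁ := D * B.hdeg + 2 * T' with hP₁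
  have hA1 := B.one_le_houseBound D' T S₀
  have hHξ := B.houseXi_le ξ hξ hW1 hWD hqp hp
  rw [← hn] at hHξ
  have hkW : (k : ℝ) ≤ W := le_trans (by exact_mod_cast hk) hWT'
  have hU : (Fintype.card (UIdx β γ δ D') : ℝ) ≤ W ^ n := by
    rw [card_UIdx]; push_cast; exact pow_le_pow_left₀ (by positivity) hWD n
  -- the factors
  have f1 : (B.dd : ℝ) ^ k ≤ B.bigConst ^ T' :=
    (pow_le_pow_left₀ (Nat.cast_nonneg _) (by linarith : (B.dd : ℝ) ≤ B.bigConst) k).trans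
      (pow_le_pow_right₀ hG1 hk)
  have f2 : (k : ℝ) ^ k ≤ W ^ T' := (pow_le_pow_left₀ (Nat.cast_nonneg _) hkW k).trans (pow_le_pow_right₀ hW1 hk)
  have f5 : (((D * B.hdeg : ℕ) : ℝ) + 2 * k) ^ k ≤ W ^ T' := by
    have : ((D * B.hdeg : ℕ) : ℝ) + 2 * k ≤ W := by
      have : (k : ℝ) ≤ T' := by exact_mod_cast hk
      rw [hD]; linarith
    exact (pow_le_pow_left₀ (by positivity) this k).trans (pow_le_pow_right₀ hW1 hk)
  have f6 : B.qB ^ k ≤ B.bigConst ^ T' :=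
    ((pow_le_pow_left₀ B.qB_nonneg ((le_max_right 1 B.qB).trans hqB) k)).trans (pow_le_pow_right₀ hG1 hk)
  have f7 : B.hB ^ D ≤ B.bigConst ^ D := pow_le_pow_left₀ (zero_le_one.trans B.one_le_hB) hhB _
  have hg1 := B.one_le_gBound s
  have hg0 : (0 : ℝ) ≤ B.gBound s := zero_le_one.trans hg1
  have hgs : B.gBound s ≤ B.bigConst ^ ((S₁ + 1) ^ 3) := (B.gBound_mono hs).trans (B.gBound_le_pow S₁)
  have f8 : B.gBound s ^ (D * B.hdeg + 2 * k) ≤ (B.bigConst ^ ((S₁ + 1) ^ 3)) ^ P₁ :=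
    (pow_le_pow_left₀ hg0 hgs _).trans (pow_le_pow_right₀ (one_le_pow₀ hG1) (by rw [hP₁]; omega))
  -- nonnegativity
  have n2 : (0 : ℝ) ≤ (k : ℝ) ^ k := by positivity
  have n3 : (0 : ℝ) ≤ (Fintype.card (UIdx β γ δ D') : ℝ) := Nat.cast_nonneg _
  have n4 : (0 : ℝ) ≤ B.houseXi ξ := zero_le_one.trans (B.one_le_houseXi ξ)
  have n6 : (0 : ℝ) ≤ B.qB ^ k := pow_nonneg B.qB_nonneg _
  have n7 : (0 : ℝ) ≤ B.hB ^ D := pow_nonneg (zero_le_one.trans B.one_le_hB) _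
  have n8 : (0 : ℝ) ≤ B.gBound s ^ (D * B.hdeg + 2 * k) := pow_nonneg hg0 _
  unfold lineValBound
  rw [← hn, ← hD]
  calc (B.dd : ℝ) ^ k * (k : ℝ) ^ k * (Fintype.card (UIdx β γ δ D') : ℝ) * B.houseXi ξ *
        ((((D * B.hdeg : ℕ) : ℝ) + 2 * k) ^ k * B.qB ^ k * B.hB ^ D * B.gBound s ^ (D * B.hdeg + 2 * k))
      ≤ B.bigConst ^ T' * W ^ T' * W ^ n * (B.bigConst ^ 3 * W ^ (2 * n) * B.houseBound D' T S₀) *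
          (W ^ T' * B.bigConst ^ T' * B.bigConst ^ D * (B.bigConst ^ ((S₁ + 1) ^ 3)) ^ P₁) := by
        refine mul_le_mul (mul_le_mul (mul_le_mul (mul_le_mul f1 f2 n2 (by positivity)) hU n3 (by positivity))
          hHξ n4 (by positivity)) (mul_le_mul (mul_le_mul (mul_le_mul f5 f6 n6 (by positivity)) f7 n7
          (by positivity)) f8 n8 (by positivity)) (by positivity) (by positivity)
    _ = B.bigConst ^ (2 * T' + 3 + D + (S₁ + 1) ^ 3 * P₁) * W ^ (2 * T' + 3 * n) * B.houseBound D' T S₀ := by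
        rw [← pow_mul]; ring


end BakerDataG

end Std

end GaGmEFam

end Literature.NumberTheory.Transcendental

end
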